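import Literature.NumberTheory.GaloisRepresentations.HeckeCharacterValueFieldProofs
import Literature.NumberTheory.GaloisRepresentations.HeckeCharacterWeakApproximation
import HarnessLib

/-!
# The values of an algebraic Hecke character on the finite ideles lie in Weil's number field (proved)

Topic `NumberTheory/GaloisRepresentations`; namespace `Literature.NumberTheory.GaloisRepresentations.HeckeCharacter`.
Proofs-only companion (theorems; no definition, no named fact, no instance — D-0026) of
`HeckeCharacterValueFieldProofs` (Weil 1956: for an algebraic Hecke character `χ` there is one number field
`E ⊆ ℂ`, containing every conjugate of `K`, with `χ(ϖ_v) ∈ E` at every UNRAMIFIED place `v`,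
`IsAlgebraic.exists_intermediateField_valueAtUniformizer_mem`).  Here the statement is carried from the
unramified uniformisers to ALL finite ideles: on a totally complex number field `K`, any subfield `F ⊆ ℂ`
containing the conjugates of `K` and the `χ(ϖ_v)` at the unramified `v` already contains `χ(x)` for every
idele `x` with archimedean component `1` (`HasInfinityType.coe_apply_mem_of_fst_eq_one`), whence
`IsAlgebraic.exists_numberField_coe_apply_mem_of_fst_eq_one`: **the values of `χ` on `(𝔸_K^∞)^×` lie in one
number field.**  This is the form in which [Liu2021] §4.1 uses Weil's theorem: "Denote by `M_μ ⊆ ℂ` the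
subfield generated by values `μ^{alg}(x)` for `x ∈ (𝔸_E^∞)^×`, which is a number field" (TeX ll. 1926–1927; `E`
a CM field, `μ^{alg} = μ|·|_E^{-1/2}` an algebraic Hecke character — `Automorphic/IdeleClassCharacterAlgebraicTwist`).

THE ARGUMENT (Neukirch's decomposition of ideles + weak approximation; cf. the `K = ℚ` template
`HeckeCharacter.Rat.map_localUnits_of_isModulus` in `HeckeCharacterProofs`).  Fix a module of definition
`(T, e)` supported on the ramified places (`exists_isModulus_of_ramified`).
* `coe_apply_eq_prod_localUnits_of_fst_eq_one` — a finite idele `x` is `∏_{w ∈ S} ⟨x_w⟩_w` times an idele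
  of `I_f^𝔪` (killed by `χ`) for any finite `S ⊇ T` outside which `x` is a unit, so
  `χ(x) = ∏_{w ∈ S} χ(⟨x_w⟩_w)` [Neukirch VII §6, proof of (6.13)].
* `coe_map_localUnits_eq_valueAtUniformizer_zpow` — at an unramified `w`, `χ(⟨z⟩_w) = χ(ϖ_w)^{ord_w z}`
  (`K_wˣ = ϖ_w^ℤ 𝒪_wˣ`) [Tate, Cassels–Fröhlich XV §2.5; Neukirch VII (6.12)]; these lie in `F`.
* `IsModulus.map_localUnits_eq_one_of_mem` — at `w ∈ T`, `χ(⟨u⟩_w) = 1` for `u ∈ 𝒪_wˣ`, `u ≡ 1 mod 𝔭_w^{e_w}`.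
* `exists_approx_at_finset` — weak approximation at the finitely many places of `T` (`denseRange_algebraMap_pi_prod`,
  [Cassels–Fröhlich II §6]): for `v ∈ T` and `z ∈ K_vˣ` there is `k ∈ Kˣ` with `k ≡ z mod z·𝔭_v^{e_v+1}` and
  `k ≡ 1 mod 𝔭_w^{e_w+1}` for `w ∈ T ∖ {v}`.
* `HasInfinityType.coe_map_localUnits_mem` — hence at `v ∈ T`: `χ(⟨z⟩_v) = χ(⟨k⟩_v)`, and by Neukirch's
  decomposition of the PRINCIPAL idele `k` (`map_principalIdele_eq`),
  `χ(⟨k⟩_v) = (χ((k)_∞) · ∏_{w ∈ S ∖ {v}} χ(⟨k⟩_w))⁻¹` where `χ((k)_∞) = ∏_σ σ(k)^{-p_σ} \bar σ(k)^{-q_σ}`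
  (`HasInfinityType.apply_globalToInfiniteUnits_eq`; no sign condition since `K` has no real place),
  `χ(⟨k⟩_w) = 1` for `w ∈ T ∖ {v}` and `χ(⟨k⟩_w) = χ(ϖ_w)^{ord_w k}` off `T` — all in `F`.
Restricting to totally complex `K` only serves to dispense with the total-positivity bookkeeping at the
real places (`-- TODO(general form)`); the CM fields of [Liu2021] are totally complex.

## References

* [Weil1956] A. Weil, *On a certain type of characters of the idèle-class group of an algebraic number-field*,
  Proc. Int. Symp. Tokyo–Nikko 1955 (1956), 1–7, §1.
* [Liu2021] Y. Liu, *Fourier–Jacobi cycles and arithmetic relative trace formula*, Camb. J. Math. 9 (2021),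
  1–147 = arXiv:2102.11518, §4.1 (text after Def. 4.3, TeX ll. 1922–1927).
* [NeukirchANT1999] J. Neukirch, *Algebraic Number Theory* (1999), Ch. VII §6 (6.11)–(6.13).
* [CasselsFrohlichANT1967] J. W. S. Cassels, A. Fröhlich (eds.), *Algebraic Number Theory* (1967), Ch. II §6
  (weak approximation), Ch. XV (Tate) §2.5.
-/

set_option autoImplicit false

noncomputable section

open scoped NNReal ComplexConjugate Topology
open NumberField IsDedekindDomain NumberField.InfinitePlace NumberField.InfinitePlace.Completion Filter

namespace Literature.NumberTheory.GaloisRepresentations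

namespace HeckeCharacter

variable {K : Type} [Field K] [NumberField K]

/-! ### §1. Local values: unramified places, and places of a module of definition -/

/-- **`χ(⟨z⟩_w) = χ(ϖ_w)^{-a}` at an unramified place**, where `|z|_w = exp(a)` (so `ord_w z = -a`):
`K_wˣ = ϖ_w^ℤ · 𝒪_wˣ`, `χ` kills `𝒪_wˣ`, and `χ(⟨ϖ_w⟩_w) = χ(ϖ_w)` (`valueAtUniformizer`).
[cite: TateThesis1967, §2.5] [cite: NeukirchANT1999, Ch. VII §6 (6.12)] -/
theorem coe_map_localUnits_eq_valueAtUniformizer_zpow {χ : HeckeCharacter K} {v : HeightOneSpectrum (𝓞 K)}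
    (h1 : χ.IsUnramifiedAt v) (z : (v.adicCompletion K)ˣ) :
    ((χ (localUnits v z) : ℂˣ) : ℂ) =
      χ.valueAtUniformizer v ^ (-(WithZero.log (Valued.v (z : v.adicCompletion K)))) := by
  set π := HeckeCharacter.uniformizer K v with hπ
  have hz0 : Valued.v (z : v.adicCompletion K) ≠ 0 := (map_ne_zero _).2 z.ne_zero
  set a : ℤ := WithZero.log (Valued.v (z : v.adicCompletion K)) with ha
  have hza : Valued.v (z : v.adicCompletion K) = WithZero.exp a := (WithZero.exp_log hz0).symm
  have hu : Valued.v ((z * π ^ a : (v.adicCompletion K)ˣ) : v.adicCompletion K) = 1 := by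
    rw [Units.val_mul, Units.val_zpow_eq_zpow_val, map_mul, map_zpow₀, hza,
      HeckeCharacter.valued_uniformizer, ← WithZero.exp_zsmul, smul_eq_mul, mul_neg, mul_one,
      ← WithZero.exp_add, add_neg_cancel, WithZero.exp_zero]
  have hπ1 : ((χ (localUnits v π) : ℂˣ) : ℂ) = χ.valueAtUniformizer v := by
    rw [← HeckeCharacter.localComponent_apply]; rfl
  have hz : z = (z * π ^ a) * π ^ (-a) := by
    rw [mul_assoc, ← zpow_add, add_neg_cancel, zpow_zero, mul_one]
  rw [hz, map_mul, map_mul, map_zpow, map_zpow, h1.map_localUnits_eq_one _ hu, one_mul,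
    Units.val_zpow_eq_zpow_val, hπ1]

/-- **A module of definition kills the congruent local units**: if `(T, e)` is a module of definition of `χ`
and `v ∈ T`, then `χ(⟨u⟩_v) = 1` for every `u ∈ 𝒪_vˣ` with `u ≡ 1 mod 𝔭_v^{e_v}` (the idele `⟨u⟩_v` lies in
`I_f^𝔪`). [cite: NeukirchANT1999, Ch. VII §6 (6.11)] -/
theorem IsModulus.map_localUnits_eq_one_of_mem {χ : HeckeCharacter K} {T : Finset (HeightOneSpectrum (𝓞 K))}
    {e : HeightOneSpectrum (𝓞 K) → ℕ} (hmod : IsModulus χ T e) {v : HeightOneSpectrum (𝓞 K)}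
    (u : (v.adicCompletion K)ˣ) (hu : Valued.v (u : v.adicCompletion K) = 1)
    (hcong : Valued.v ((u : v.adicCompletion K) - 1) ≤ WithZero.exp (-(e v : ℤ))) :
    χ (localUnits v u) = 1 := by
  refine hmod _ (localUnits_fst v _) (fun w => ?_) (fun w hw => ?_)
  · by_cases hwv : w = v
    · subst hwv
      rw [localUnits_snd_apply_self]
      exact hu
    · rw [localUnits_snd_apply_of_ne _ hwv, map_one]
  · by_cases hwv : w = v
    · subst hwv
      rw [localUnits_snd_apply_self]
      exact hcong
    · rw [localUnits_snd_apply_of_ne _ hwv, sub_self, map_zero]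
      exact zero_le

/-! ### §2. Neukirch's decomposition of a finite idele -/

/-- **`χ(x) = ∏_{w ∈ S} χ(⟨x_w⟩_w)` for a finite idele `x`** (`x_∞ = 1`), `(T, e)` a module of definition of
`χ` and `S ⊇ T` a finite set of places outside which `x` is a unit: `x · (∏_{w ∈ S} ⟨x_w⟩_w)⁻¹` has all its
components units, equal to `1` at `S ⊇ T`, so lies in `I_f^𝔪 ⊆ ker χ`.
[cite: NeukirchANT1999, Ch. VII §6 Prop. (6.13) (proof)] -/
theorem IsModulus.coe_apply_eq_prod_localUnits_of_fst_eq_one {χ : HeckeCharacter K}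
    {T : Finset (HeightOneSpectrum (𝓞 K))} {e : HeightOneSpectrum (𝓞 K) → ℕ} (hmod : IsModulus χ T e)
    (x : ideleGroup K) (hx1 : (x : AdeleRing (𝓞 K) K).1 = 1) {S : Finset (HeightOneSpectrum (𝓞 K))}
    (hTS : T ⊆ S) (hS : ∀ w ∉ S, Valued.v ((x : AdeleRing (𝓞 K) K).2 w) = 1) :
    χ x = ∏ w ∈ S, χ (localUnits w (Units.mk0 ((x : AdeleRing (𝓞 K) K).2 w) (ideleGroup_snd_ne_zero x w))) := by
  classical
  let u : ∀ q : HeightOneSpectrum (𝓞 K), (q.adicCompletion K)ˣ := fun q =>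
    Units.mk0 ((x : AdeleRing (𝓞 K) K).2 q) (ideleGroup_snd_ne_zero x q)
  set G : ideleGroup K := ∏ q ∈ S, localUnits q (u q) with hG
  have hz : χ (x * G⁻¹) = 1 := by
    refine hmod _ ?_ (fun w => ?_) (fun w hw => ?_)
    · rw [ideleGroup_val_fst_mul, hx1, one_mul]
      have h := ideleGroup_val_inv_fst_mul G
      rwa [hG, fst_prod_localUnits, mul_one] at h
    · rw [ideleGroup_val_snd_mul, ideleGroup_val_inv_snd, hG, snd_prod_localUnits]
      split_ifs with hw
      · rw [Units.val_mk0, mul_inv_cancel₀ (ideleGroup_snd_ne_zero x w), map_one]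
      · rw [inv_one, mul_one]
        exact hS w hw
    · rw [ideleGroup_val_snd_mul, ideleGroup_val_inv_snd, hG, snd_prod_localUnits, if_pos (hTS hw),
        Units.val_mk0, mul_inv_cancel₀ (ideleGroup_snd_ne_zero x w), sub_self, map_zero]
      exact zero_le
  rw [map_mul, map_inv, mul_inv_eq_one] at hz
  rw [hz, hG, map_prod]

/-! ### §3. Weak approximation at the places of `T` -/

/-- Congruence balls `{c | |c - c₀|_v < |b|_v}` are open. [folklore] -/
private theorem isOpen_setOf_valued_sub_lt (v : HeightOneSpectrum (𝓞 K)) (c₀ b : v.adicCompletion K) :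
    IsOpen {c : v.adicCompletion K | Valued.v (c - c₀) < Valued.v b} := by
  have h1 : IsOpen {y : v.adicCompletion K | Valued.v y < Valued.v b} := by
    simpa only [Valuation.restrict_lt_iff] using
      Valued.isOpen_ball (v.adicCompletion K) (Valued.v.restrict b)
  exact h1.preimage (continuous_id.sub continuous_const)

/-- `|ϖ_v^n|_v = exp(-n)`. [folklore] -/
private theorem valued_uniformizer_pow (v : HeightOneSpectrum (𝓞 K)) (n : ℕ) :
    Valued.v (((uniformizer K v : (v.adicCompletion K)ˣ) : v.adicCompletion K) ^ n) =
      WithZero.exp (-(n : ℤ)) := by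
  rw [map_pow, valued_uniformizer, ← WithZero.exp_nsmul]
  congr 1
  simp

/-- **Weak approximation at the places of a finite set `T`** (Cassels–Fröhlich II §6): for `v ∈ T`,
`z ∈ K_vˣ` and exponents `e`, there is `k ∈ K` with `|k - z|_v < |z ϖ_v^{e_v+1}|_v` (so `k ∈ z(1 + 𝔭_v^{e_v+1})`)
and `|k - 1|_w < |ϖ_w^{e_w+1}|_w` for the other `w ∈ T`. [cite: CasselsFrohlichANT1967, Ch. II §6 Lemma (weak approximation theorem)] -/
theorem exists_approx_at_finset (T : Finset (HeightOneSpectrum (𝓞 K))) (e : HeightOneSpectrum (𝓞 K) → ℕ)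
    {v : HeightOneSpectrum (𝓞 K)} (hv : v ∈ T) (z : (v.adicCompletion K)ˣ) :
    ∃ k : K,
      Valued.v (algebraMap K (v.adicCompletion K) k - (z : v.adicCompletion K)) <
          Valued.v ((z : v.adicCompletion K) *
            ((uniformizer K v : (v.adicCompletion K)ˣ) : v.adicCompletion K) ^ (e v + 1)) ∧
        ∀ w ∈ T, w ≠ v →
          Valued.v (algebraMap K (w.adicCompletion K) k - 1) <
            Valued.v (((uniformizer K w : (w.adicCompletion K)ˣ) : w.adicCompletion K) ^ (e w + 1)) := by
  classical
  -- the target point of `(∏_{w ∈ T} K_w) × K_∞`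
  let t : ∀ w : T, w.1.adicCompletion K := fun w =>
    if h : w.1 = v then (h ▸ (z : v.adicCompletion K) : w.1.adicCompletion K) else 1
  let y₀ : (∀ w : T, w.1.adicCompletion K) × InfiniteAdeleRing K := (t, 1)
  have htv : t ⟨v, hv⟩ = (z : v.adicCompletion K) := by simp [t]
  have htw : ∀ w : T, w.1 ≠ v → t w = 1 := fun w hw => by simp [t, hw]
  -- the neighbourhood
  let Nv : Set ((∀ w : T, w.1.adicCompletion K) × InfiniteAdeleRing K) :=
    {p | Valued.v (p.1 ⟨v, hv⟩ - (z : v.adicCompletion K)) <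
      Valued.v ((z : v.adicCompletion K) *
        ((uniformizer K v : (v.adicCompletion K)ˣ) : v.adicCompletion K) ^ (e v + 1))}
  let Nw : T → Set ((∀ w : T, w.1.adicCompletion K) × InfiniteAdeleRing K) := fun w =>
    {p | w.1 ≠ v → Valued.v (p.1 w - 1) <
      Valued.v (((uniformizer K w.1 : (w.1.adicCompletion K)ˣ) : w.1.adicCompletion K) ^ (e w.1 + 1))}
  have hNv : Nv ∈ 𝓝 y₀ := by
    have hc : Continuous fun p : (∀ w : T, w.1.adicCompletion K) × InfiniteAdeleRing K => p.1 ⟨v, hv⟩ :=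
      (continuous_apply _).comp continuous_fst
    refine (isOpen_setOf_valued_sub_lt v _ _).preimage hc |>.mem_nhds ?_
    change Valued.v (y₀.1 ⟨v, hv⟩ - (z : v.adicCompletion K)) < _
    rw [show y₀.1 ⟨v, hv⟩ = t ⟨v, hv⟩ from rfl, htv, sub_self, map_zero]
    exact zero_lt_iff.2 ((map_ne_zero _).2 (mul_ne_zero z.ne_zero (pow_ne_zero _ (uniformizer K v).ne_zero)))
  have hNw : ∀ w : T, Nw w ∈ 𝓝 y₀ := by
    intro w
    by_cases hw : w.1 = v
    · exact Filter.univ_mem' fun p h => absurd hw h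
    · have hc : Continuous fun p : (∀ w : T, w.1.adicCompletion K) × InfiniteAdeleRing K => p.1 w :=
        (continuous_apply _).comp continuous_fst
      have hopen : IsOpen {p : (∀ w : T, w.1.adicCompletion K) × InfiniteAdeleRing K |
          Valued.v (p.1 w - 1) <
            Valued.v (((uniformizer K w.1 : (w.1.adicCompletion K)ˣ) : w.1.adicCompletion K) ^ (e w.1 + 1))} :=
        (isOpen_setOf_valued_sub_lt w.1 _ _).preimage hc
      refine Filter.mem_of_superset (hopen.mem_nhds ?_) fun p hp _ => hp
      change Valued.v (y₀.1 w - 1) < _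
      rw [show y₀.1 w = t w from rfl, htw w hw, sub_self, map_zero]
      exact zero_lt_iff.2 ((map_ne_zero _).2 (pow_ne_zero _ (uniformizer K w.1).ne_zero))
  have hN : Nv ∩ ⋂ w : T, Nw w ∈ 𝓝 y₀ := Filter.inter_mem hNv ((Filter.iInter_mem).2 hNw)
  obtain ⟨k, hkv, hkw⟩ := (denseRange_algebraMap_pi_prod T).mem_nhds hN
  refine ⟨k, hkv, fun w hwT hwv => ?_⟩
  have := Set.mem_iInter.1 hkw ⟨w, hwT⟩
  exact this hwv

/-! ### §4. The values at all places lie in `F` -/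

omit [NumberField K] in
/-- A totally complex field has no real embedding. [folklore] -/
private theorem false_of_ringHom_real [IsTotallyComplex K] (φ : K →+* ℝ) : False := by
  have hreal : ComplexEmbedding.IsReal (Complex.ofRealHom.comp φ) := by
    rw [ComplexEmbedding.isReal_iff]
    ext x
    simp only [ComplexEmbedding.conjugate_coe_eq, RingHom.coe_comp, Function.comp_apply,
      Complex.ofRealHom_eq_coe, Complex.conj_ofReal]
  have h : (InfinitePlace.mk (Complex.ofRealHom.comp φ)).IsReal := ⟨_, hreal, rfl⟩
  exact InfinitePlace.not_isReal_iff_isComplex.2 (IsTotallyComplex.isComplex _) h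

/-- On a totally complex field, `χ((k)_∞) = ∏_w σ_w(k)^{-p_w} \bar σ_w(k)^{-q_w}` for EVERY `k ∈ Kˣ` (the
positivity condition of `HasInfinityType.apply_globalToInfiniteUnits_eq` is void).
[cite: NeukirchANT1999, Ch. VII §6 Prop. (6.9)] -/
theorem HasInfinityType.apply_globalToInfiniteUnits_eq_of_isTotallyComplex [IsTotallyComplex K]
    {χ : HeckeCharacter K} {p q : InfinitePlace K → ℤ} (h : χ.HasInfinityType p q) (k : Kˣ) :
    (χ (infiniteIdeles K (globalToInfiniteUnits K k)) : ℂ) =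
      ∏ w : InfinitePlace K, w.embedding (k : K) ^ (-p w) * conj (w.embedding (k : K)) ^ (-q w) :=
  h.apply_globalToInfiniteUnits_eq fun φ => (false_of_ringHom_real φ).elim

/-- The archimedean value `χ((k)_∞)` of a principal idele lies in any subfield containing the conjugates of `K`.
[cite: Weil1956, §1] -/
theorem HasInfinityType.coe_apply_globalToInfiniteUnits_mem [IsTotallyComplex K] {χ : HeckeCharacter K}
    {p q : InfinitePlace K → ℤ} (h : χ.HasInfinityType p q) {F : Subfield ℂ}
    (hF : ∀ (φ : K →+* ℂ) (x : K), φ x ∈ F) (k : Kˣ) :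
    ((χ (infiniteIdeles K (globalToInfiniteUnits K k)) : ℂˣ) : ℂ) ∈ F := by
  rw [h.apply_globalToInfiniteUnits_eq_of_isTotallyComplex k]
  refine Subfield.prod_mem _ fun w _ => F.mul_mem (F.zpow_mem (hF _ _) _) (F.zpow_mem ?_ _)
  exact hF (ComplexEmbedding.conjugate w.embedding) (k : K)

/-- **The local values at a ramified place lie in `F`.**  Let `K` be totally complex, `χ` of infinity type
`(p, q)` with module of definition `(T, e)`, and `F ⊆ ℂ` a subfield containing the conjugates of `K` and the
`χ(ϖ_w)`, `w ∉ T`.  Then `χ(⟨z⟩_v) ∈ F` for every `v ∈ T` and `z ∈ K_vˣ`: choose `k ∈ Kˣ` with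
`k ≡ z mod z𝔭_v^{e_v+1}` and `k ≡ 1 mod 𝔭_w^{e_w+1}` (`w ∈ T ∖ {v}`); then `χ(⟨z⟩_v) = χ(⟨k⟩_v)` and
`χ(⟨k⟩_v) = (χ((k)_∞) ∏_{w ∈ S ∖ {v}} χ(⟨k⟩_w))⁻¹` by the decomposition of the principal idele `k`.
[cite: Weil1956, §1] [cite: NeukirchANT1999, Ch. VII §6 Prop. (6.13) (proof)] -/
theorem HasInfinityType.coe_map_localUnits_mem [IsTotallyComplex K] {χ : HeckeCharacter K}
    {p q : InfinitePlace K → ℤ} (h : χ.HasInfinityType p q) {T : Finset (HeightOneSpectrum (𝓞 K))}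
    {e : HeightOneSpectrum (𝓞 K) → ℕ} (hmod : IsModulus χ T e) {F : Subfield ℂ}
    (hF : ∀ (φ : K →+* ℂ) (x : K), φ x ∈ F)
    (hFT : ∀ w ∉ T, χ.valueAtUniformizer w ∈ F)
    (v : HeightOneSpectrum (𝓞 K)) (z : (v.adicCompletion K)ˣ) :
    ((χ (localUnits v z) : ℂˣ) : ℂ) ∈ F := by
  classical
  -- off `T`: unramified
  by_cases hv : v ∈ T
  swap
  · rw [coe_map_localUnits_eq_valueAtUniformizer_zpow (isUnramifiedAt_of_isModulus' hmod hv)]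
    exact F.zpow_mem (hFT v hv) _
  -- on `T`: approximate `z` by a global `k`
  obtain ⟨k, hkv, hkw⟩ := exists_approx_at_finset T e hv z
  set π := (uniformizer K v : (v.adicCompletion K)ˣ) with hπ
  have hz0 : Valued.v (z : v.adicCompletion K) ≠ 0 := (map_ne_zero _).2 z.ne_zero
  have hπe : Valued.v ((π : v.adicCompletion K) ^ (e v + 1)) = WithZero.exp (-((e v + 1 : ℕ) : ℤ)) :=
    valued_uniformizer_pow v (e v + 1)
  have hlt1 : WithZero.exp (-((e v + 1 : ℕ) : ℤ)) < 1 := by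
    rw [← WithZero.exp_zero, WithZero.exp_lt_exp]; omega
  -- `|k - z| < |z|`, so `|k|_v = |z|_v ≠ 0` and `k ≠ 0`
  have hkz : Valued.v (algebraMap K (v.adicCompletion K) k - (z : v.adicCompletion K)) <
      Valued.v (z : v.adicCompletion K) := by
    refine lt_of_lt_of_le hkv ?_
    rw [map_mul, hπe]
    calc Valued.v (z : v.adicCompletion K) * WithZero.exp (-((e v + 1 : ℕ) : ℤ))
        ≤ Valued.v (z : v.adicCompletion K) * 1 := mul_le_mul' le_rfl hlt1.le
      _ = _ := mul_one _
  have hkval : Valued.v (algebraMap K (v.adicCompletion K) k) = Valued.v (z : v.adicCompletion K) :=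
    Valuation.map_eq_of_sub_lt _ hkz
  have hk0 : k ≠ 0 := by
    rintro rfl
    rw [map_zero, map_zero] at hkval
    exact hz0 hkval.symm
  set A : Kˣ := Units.mk0 k hk0 with hA
  -- the unit `u = k_v z⁻¹ ≡ 1`
  set u : (v.adicCompletion K)ˣ := globalToLocalUnits v A * z⁻¹ with hu
  have hu_sub : (u : v.adicCompletion K) - 1 =
      (algebraMap K (v.adicCompletion K) k - (z : v.adicCompletion K)) * (z : v.adicCompletion K)⁻¹ := by
    rw [hu, Units.val_mul, Units.val_inv_eq_inv_val, val_globalToLocalUnits, hA, Units.val_mk0, sub_mul,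
      mul_inv_cancel₀ z.ne_zero]
  have hu_lt : Valued.v ((u : v.adicCompletion K) - 1) < WithZero.exp (-((e v + 1 : ℕ) : ℤ)) := by
    rw [hu_sub, map_mul, map_inv₀, mul_inv_lt_iff₀ (zero_lt_iff.2 hz0), ← hπe, mul_comm, ← map_mul]
    exact hkv
  have hu1 : Valued.v (u : v.adicCompletion K) = 1 := by
    have := Valuation.map_eq_of_sub_lt (Valued.v) (x := (1 : v.adicCompletion K))
      (y := (u : v.adicCompletion K)) (by rw [map_one]; exact hu_lt.trans hlt1)
    rwa [map_one] at this
  have hucong : Valued.v ((u : v.adicCompletion K) - 1) ≤ WithZero.exp (-(e v : ℤ)) :=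
    hu_lt.le.trans (WithZero.exp_le_exp.2 (by push_cast; omega))
  have hχu : χ (localUnits v u) = 1 := hmod.map_localUnits_eq_one_of_mem u hu1 hucong
  -- `χ(⟨z⟩_v) = χ(⟨k⟩_v)`
  have hzk : χ (localUnits v z) = χ (localUnits v (globalToLocalUnits v A)) := by
    have : z = globalToLocalUnits v A * u⁻¹ := by rw [hu, mul_inv_rev, inv_inv, mul_comm z, mul_inv_cancel_left]
    rw [this, map_mul, map_mul, map_inv, map_inv, hχu, inv_one, mul_one]
  rw [hzk]
  -- decomposition of the principal idele `k` over `S = T ∪ {w : |k|_w ≠ 1}`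
  have hfin := ideleGroup_valued_snd_eventually_eq_one (principalIdele K A)
  rw [Filter.eventually_cofinite] at hfin
  set S : Finset (HeightOneSpectrum (𝓞 K)) := T ∪ hfin.toFinset with hS
  have hTS : T ⊆ S := Finset.subset_union_left
  have hSout : ∀ w ∉ S, w.valuation K (A : K) = 1 := by
    intro w hw
    by_contra hne
    refine hw (Finset.mem_union_right _ (hfin.mem_toFinset.2 ?_))
    rw [Set.mem_setOf_eq, principalIdele_snd, valued_algebraMap_adicCompletion]
    exact hne
  have hdec := map_principalIdele_eq hmod A hTS hSout
  have hvS : v ∈ S := hTS hv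
  rw [← Finset.mul_prod_erase S _ hvS] at hdec
  -- `χ(⟨k⟩_v) = (χ((k)_∞) ∏_{w ≠ v} χ(⟨k⟩_w))⁻¹`
  have hsolve : χ (localUnits v (globalToLocalUnits v A)) =
      (χ (infiniteIdeles K (globalToInfiniteUnits K A)) *
        ∏ w ∈ S.erase v, χ (localUnits w (globalToLocalUnits w A)))⁻¹ := by
    rw [eq_inv_iff_mul_eq_one, ← hdec]
    ac_rfl
  rw [hsolve, Units.val_inv_eq_inv_val, Units.val_mul, Units.coe_prod]
  refine F.inv_mem (F.mul_mem (h.coe_apply_globalToInfiniteUnits_mem hF A) (Subfield.prod_mem _ fun w hw => ?_))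
  have hwv : w ≠ v := (Finset.mem_erase.1 hw).1
  by_cases hwT : w ∈ T
  · -- `k ≡ 1 mod 𝔭_w^{e_w+1}`: `χ(⟨k⟩_w) = 1`
    have hk1 := hkw w hwT hwv
    have hπw : Valued.v (((uniformizer K w : (w.adicCompletion K)ˣ) : w.adicCompletion K) ^ (e w + 1)) =
        WithZero.exp (-((e w + 1 : ℕ) : ℤ)) := valued_uniformizer_pow w (e w + 1)
    have hlt1w : WithZero.exp (-((e w + 1 : ℕ) : ℤ)) < 1 := by
      rw [← WithZero.exp_zero, WithZero.exp_lt_exp]; omega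
    rw [hπw] at hk1
    have hkw1 : Valued.v ((globalToLocalUnits w A : (w.adicCompletion K)ˣ) : w.adicCompletion K) = 1 := by
      rw [val_globalToLocalUnits, hA, Units.val_mk0]
      have := Valuation.map_eq_of_sub_lt (Valued.v) (x := (1 : w.adicCompletion K))
        (y := algebraMap K (w.adicCompletion K) k) (by rw [map_one]; exact hk1.trans hlt1w)
      rwa [map_one] at this
    have hkwcong : Valued.v (((globalToLocalUnits w A : (w.adicCompletion K)ˣ) : w.adicCompletion K) - 1) ≤
        WithZero.exp (-(e w : ℤ)) := by
      rw [val_globalToLocalUnits, hA, Units.val_mk0]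
      exact hk1.le.trans (WithZero.exp_le_exp.2 (by push_cast; omega))
    rw [hmod.map_localUnits_eq_one_of_mem _ hkw1 hkwcong, Units.val_one]
    exact F.one_mem
  · rw [coe_map_localUnits_eq_valueAtUniformizer_zpow (isUnramifiedAt_of_isModulus' hmod hwT)]
    exact F.zpow_mem (hFT w hwT) _

/-- **The values of an algebraic Hecke character on the finite ideles lie in Weil's field.**  Let `K` be a
totally complex number field, `χ` a Hecke character of infinity type `(p, q)`, and `F ⊆ ℂ` a subfield containing
every conjugate of `K` and the values `χ(ϖ_v)` at the unramified places `v`.  Then `χ(x) ∈ F` for every idele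
`x` with archimedean component `x_∞ = 1` (decompose `x` at a module of definition and use
`coe_map_localUnits_mem` place by place).  With `F` = the number field of
`IsAlgebraic.exists_intermediateField_valueAtUniformizer_mem` this is Weil's theorem in the idelic form used by
[Liu2021] §4.1 ("`M_μ` … is a number field").  -- TODO(general form): fields with real places (track the
signs of `k` at the real embeddings in the approximation step).
[cite: Weil1956, §1] [cite: Liu2021, §4.1 (after Def. 4.3, TeX ll. 1926–1927)] -/
theorem HasInfinityType.coe_apply_mem_of_fst_eq_one [IsTotallyComplex K] {χ : HeckeCharacter K}
    {p q : InfinitePlace K → ℤ} (h : χ.HasInfinityType p q) {F : Subfield ℂ}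
    (hF : ∀ (φ : K →+* ℂ) (x : K), φ x ∈ F)
    (hFu : ∀ v : HeightOneSpectrum (𝓞 K), χ.IsUnramifiedAt v → χ.valueAtUniformizer v ∈ F)
    (x : ideleGroup K) (hx1 : (x : AdeleRing (𝓞 K) K).1 = 1) : ((χ x : ℂˣ) : ℂ) ∈ F := by
  classical
  obtain ⟨e, hmod⟩ := χ.exists_isModulus_of_ramified
  set T := (finite_ramifiedPlaces_holds χ).toFinset with hT
  have hFT : ∀ w ∉ T, χ.valueAtUniformizer w ∈ F := fun w hw =>
    hFu w (by
      by_contra hr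
      exact hw ((finite_ramifiedPlaces_holds χ).mem_toFinset.2 hr))
  have hfin := ideleGroup_valued_snd_eventually_eq_one x
  rw [Filter.eventually_cofinite] at hfin
  set S : Finset (HeightOneSpectrum (𝓞 K)) := T ∪ hfin.toFinset with hS
  have hSout : ∀ w ∉ S, Valued.v ((x : AdeleRing (𝓞 K) K).2 w) = 1 := by
    intro w hw
    by_contra hne
    exact hw (Finset.mem_union_right _ (hfin.mem_toFinset.2 hne))
  rw [hmod.coe_apply_eq_prod_localUnits_of_fst_eq_one x hx1 Finset.subset_union_left hSout, Units.coe_prod]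
  exact Subfield.prod_mem _ fun w _ => h.coe_map_localUnits_mem hmod hF hFT w _

/-- **Weil's theorem, idelic form** ([Liu2021] §4.1: "`M_μ ⊆ ℂ` the subfield generated by values `μ^{alg}(x)` for
`x ∈ (𝔸_E^∞)^×`, which is a number field"): for an algebraic Hecke character `χ` of a totally complex number
field `K` there is ONE subfield `E ⊆ ℂ`, finite over `ℚ` and containing every conjugate of `K`, which contains
`χ(x)` for every idele `x` with `x_∞ = 1`.
[cite: Weil1956, §1] [cite: Liu2021, §4.1 (after Def. 4.3, TeX ll. 1926–1927)] -/
theorem IsAlgebraic.exists_numberField_coe_apply_mem_of_fst_eq_one [IsTotallyComplex K] {χ : HeckeCharacter K}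
    (hχ : χ.IsAlgebraic) :
    ∃ E : IntermediateField ℚ ℂ, FiniteDimensional ℚ E ∧ (∀ (φ : K →+* ℂ) (x : K), φ x ∈ E) ∧
      ∀ x : ideleGroup K, (x : AdeleRing (𝓞 K) K).1 = 1 → ((χ x : ℂˣ) : ℂ) ∈ E := by
  obtain ⟨p, q, h⟩ := (χ.isAlgebraic_iff_exists_hasInfinityType).mp hχ
  obtain ⟨E, hfd, hemb, hval⟩ := hχ.exists_intermediateField_valueAtUniformizer_mem
  refine ⟨E, hfd, hemb, fun x hx => ?_⟩
  have := h.coe_apply_mem_of_fst_eq_one (F := E.toSubfield) (fun φ y => hemb φ y) (fun v hv => hval v hv) x hx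
  exact this

end HeckeCharacter

end Literature.NumberTheory.GaloisRepresentations

end
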